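import Summits.BirchSwinnertonDyer.BirchSwinnertonDyer.Theorems.ManinLocalTwoThreeCDivisionHalfPeriodGerms
import Summits.BirchSwinnertonDyer.BirchSwinnertonDyer.Theorems.ManinLocalTwoThreeCDivisionAssembly
import HarnessLib

/-!
# The `Γ₀(N)`-TRANSLATES of the `c`-division witness: `F_w = F ∣ γ_w = 12·℘_{Λ_W}(ℰ_f + w)·G·Δ^a`, `w ∈ Λ₀(f)`
(route `ManinLocalTwoThree`, crux C2 `ManinOddAtFour` stmt-BirchSwinnertonDyer-22967; cell bsd-f2-manin, prover p3 gen 19; brick 2 of the kernel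
port of E-an-152d `IndexFourForcesFullRationalTwoTorsion` in the `2 ∣ c₀` form: index `4` ∧ `|c₀| = 2` ⟹ full rational `2`-torsion)

For a modular parametrisation datum `D` of a globally minimal `W` the `c`-division witness `F = 12·℘_{Λ_W}(ℰ_f)·G·Δ^a` (p2 g20 / p3 g18:
`CDivision.exists_cDivisionWitnessCore`, `CDivGrowth`, `CDivCuspGerm.cDivCuspSeries`) has `Γ₀(N)`-stabiliser `{γ : {∞,γ∞}_f ∈ Λ_W}`.  This file
packages the family of its translates `F_w := F ∣ γ_w` (`γ_w ∈ Γ₀(N)` any element with period `{∞, γ_w ∞}_f = w ∈ Λ₀(f)`):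
* `cDivGrowth_bounded` — the witness (and hence every translate) is BOUNDED at every cusp (the tree's N6 with the conclusion `IsBoundedAtImInfty`);
* `exists_translateFamily` — ONE existential package: weight `K`, exponent `a ≥ 2`, the integer cusp form `G ≠ 0`, the family `F_w`, a rational
  series `g_F ∈ ℚ⟦X⟧` and a family of series `𝒮 : ℂ → ℂ⟦X⟧` with: `F_w` holomorphic and bounded at all cusps; `F_w ∣ γ = F_{w + {∞,γ∞}_f}`
  (`γ ∈ Γ₀(N)`); `F_w = F_{w'}` when `w − w' ∈ Λ_W`; `F_w = 12℘_{Λ_W}(ℰ_f + w)·G·Δ^a` off the poles; `Σ (g_F)ₙ𝕢ⁿ = F_w` for `w ∈ Λ_W` and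
  `Σ (𝒮 e_w)ₙ 𝕢ⁿ = F_w` for a half-period `w` (`e_w = ℘_{Λ_W}(w)`) high in the cusp; and `(𝒮 e).map σ = 𝒮 (σ e)` for every ring endomorphism
  `σ` of `ℂ` (`𝒮 e = S(e)·G·Δ^a` with `S` of `…CDivisionHalfPeriodGerms`).
In the index-`4` world (`Λ_W = 2Λ₀`) the four classes `Λ₀/Λ_W ≅ (ℤ/2)²` give four translates; their `Aut ℂ`-behaviour is read off `𝒮`.
HONEST FRAMING: analytic bookkeeping; E-an-152d, C2, Manin's conjecture and BSD are NOT proved here.  No definitions (existential packaging), no sorry.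
[cite: ShimuraIATAF1971, §2.4, Thm. 7.14] [cite: Manin1972, Prop. 1.4] [cite: Lawden1989, §6.8 eq. (6.8.11)]
-/

set_option autoImplicit false
-- lint-debt: the directory name repeats the summit name (sibling precedent `ManinLocalTwoThreeCDivisionAssembly.lean`)
set_option linter.dupNamespace false

noncomputable section

open scoped Topology PeriodPair MatrixGroups ModularForm Manifold
open Complex Filter PowerSeries CongruenceSubgroup
open UpperHalfPlane hiding I
open WeierstrassCurve Literature.NumberTheory.EllipticCurves Literature.NumberTheory.EllipticCurves.ModularForms
open Summit.BirchSwinnertonDyer.BirchSwinnertonDyer.Theorems.ManinLocalTwoThree.KummerCubeAnalytic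

namespace Summit.BirchSwinnertonDyer.BirchSwinnertonDyer.Theorems.ManinLocalTwoThree.CDivTranslate

variable {N : ℕ} [NeZero N]

/-! ## §1 Boundedness of the witness at every cusp -/

/-- **(N6) with a bounded conclusion.**  For a finite-index `Γ ≤ Γ₀(N)` there is `a ≥ 2` such that every `Γ`-invariant `F` of weight `w + 12a` equal to
`℘_{Λ_W}(ℰ_f)·(12·B_d·Δ^a)` off the poles is BOUNDED at every cusp: `IsBoundedAtImInfty (F ∣ g)` for all `g ∈ SL₂(ℤ)` (same proof as the tree's
`CDivGrowth.cDivGrowth_uniform`, whose exported growth exponent is existential). [cite: ShimuraIATAF1971, §2.4, Thm. 7.14] [folklore] -/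
theorem cDivGrowth_bounded (W : WeierstrassCurve ℚ) [W.IsElliptic] [W.IsGloballyMinimal]
    (D : ModularParametrizationData W N) (Γ : Subgroup SL(2, ℤ)) (hfi : Γ.FiniteIndex) :
    ∃ a : ℕ, 2 ≤ a ∧ ∀ (w : ℤ) (Bd : ModularForm (Gamma0 N) w) (F : ℍ → ℂ), (∀ γ ∈ Γ, F ∣[w + 12 * (a : ℤ)] γ = F) →
      (∀ τ : ℍ, eichlerIntegral D.f τ ∉ D.L.lattice →
        F τ = ℘[D.L] (eichlerIntegral D.f τ) * ((12 : ℂ) * Bd τ * ModularForm.discriminant τ ^ a)) →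
      ∀ g : SL(2, ℤ), IsBoundedAtImInfty (F ∣[w + 12 * (a : ℤ)] g) := by
  classical
  haveI := hfi
  have hf : D.f ≠ 0 := D.isNewformOf.1.ne_zero
  obtain ⟨R, hR⟩ := exists_finset_mul_cover Γ
  set m : SL(2, ℤ) → ℕ := fun r ↦ analyticOrderNatAt (cuspFunction N (verticalIntegral (⇑D.f ∣[(2 : ℤ)] r))) 0 with hm
  set a : ℕ := 2 + ∑ r ∈ R, (2 * m r + 1) with ha
  have haR : ∀ r ∈ R, 2 * m r + 1 ≤ a := fun r hr ↦
    (Finset.single_le_sum (f := fun r ↦ 2 * m r + 1) (fun _ _ ↦ Nat.zero_le _) hr).trans (Nat.le_add_left _ _)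
  refine ⟨a, Nat.le_add_right _ _, fun w Bd F hFinv hFeq g ↦ ?_⟩
  obtain ⟨γ, hγ, r, hr, hg⟩ := hR g
  have hslash : F ∣[w + 12 * (a : ℤ)] g = F ∣[w + 12 * (a : ℤ)] r := by
    rw [hg, SlashAction.slash_mul, hFinv γ hγ]
  obtain ⟨C, hC⟩ := exists_eichlerIntegral_smul_eq D.f r
  obtain ⟨T, hT⟩ := exists_forall_eichlerIntegral_smul_notMem D.f hf D.L r
  have hlim := (isCuspFunction_verticalIntegral_slash D.f r).tendsto_weierstrassP_mul_pow_atImInfty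
    (verticalIntegral_slash_ne_zero D.f hf r) isCuspFunction_discriminant D.L C (haR r hr)
  have hev : ∀ᶠ τ : ℍ in atImInfty,
      ‖℘[D.L] (C + verticalIntegral (⇑D.f ∣[(2 : ℤ)] r) τ) * ModularForm.discriminant τ ^ a‖ < 1 := by
    have h := (Metric.tendsto_nhds.mp hlim) 1 one_pos
    filter_upwards [h] with τ hτ
    rwa [dist_zero_right] at hτ
  obtain ⟨A₁, hA₁⟩ := (atImInfty_mem _).mp hev
  obtain ⟨M, A₂, hM⟩ := UpperHalfPlane.isBoundedAtImInfty_iff.mp (ModularFormClass.bdd_at_infty_slash Bd r)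
  rw [hslash, UpperHalfPlane.isBoundedAtImInfty_iff]
  refine ⟨12 * M, max T (max A₁ A₂), fun τ hτ ↦ ?_⟩
  have hTτ : T ≤ τ.im := (le_max_left _ _).trans hτ
  have hA₁τ : A₁ ≤ τ.im := (le_max_left _ _).trans ((le_max_right _ _).trans hτ)
  have hA₂τ : A₂ ≤ τ.im := (le_max_right _ _).trans ((le_max_right _ _).trans hτ)
  have hd : denom (r : SL(2, ℤ)) τ ≠ 0 := denom_ne_zero _ τ
  have hval : (F ∣[w + 12 * (a : ℤ)] r) τ =
      ℘[D.L] (C + verticalIntegral (⇑D.f ∣[(2 : ℤ)] r) τ) * ModularForm.discriminant τ ^ a *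
        ((12 : ℂ) * (⇑Bd ∣[w] r) τ) := by
    rw [ModularForm.SL_slash_apply, ModularForm.SL_slash_apply, hFeq (r • τ) (hT τ hTτ), hC τ, discriminant_apply_smul r τ,
      mul_pow, ← zpow_natCast, ← zpow_mul, neg_add, zpow_add₀ hd, zpow_neg, zpow_neg]
    field_simp
  rw [hval]
  have h1 : ‖℘[D.L] (C + verticalIntegral (⇑D.f ∣[(2 : ℤ)] r) τ) * ModularForm.discriminant τ ^ a‖ ≤ 1 := (hA₁ τ hA₁τ).le
  have h2 : ‖(12 : ℂ) * (⇑Bd ∣[w] r) τ‖ ≤ 12 * M := by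
    rw [norm_mul, Complex.norm_ofNat]
    exact mul_le_mul_of_nonneg_left (hM τ hA₂τ) (by norm_num)
  calc ‖℘[D.L] (C + verticalIntegral (⇑D.f ∣[(2 : ℤ)] r) τ) * ModularForm.discriminant τ ^ a * ((12 : ℂ) * (⇑Bd ∣[w] r) τ)‖
      = ‖℘[D.L] (C + verticalIntegral (⇑D.f ∣[(2 : ℤ)] r) τ) * ModularForm.discriminant τ ^ a‖ * ‖(12 : ℂ) * (⇑Bd ∣[w] r) τ‖ :=
        norm_mul _ _
    _ ≤ 1 * (12 * M) := mul_le_mul h1 h2 (norm_nonneg _) zero_le_one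
    _ = 12 * M := one_mul _

/-! ## §2 The translate family -/

/-- **The family of translates of the `c`-division witness, packaged.**  For a datum `D` of a globally minimal `W` (Manin constant `c ≠ 0`, Néron pair
`D.L`, period lattice `Λ₀(f)`) there are a weight `K = k + 12a` (`a ≥ 2`), a nonzero INTEGER cusp form `G ∈ S_k(Γ₀(N))`, a family `F_w : ℍ → ℂ`
(`w ∈ ℂ`; meaningful for `w ∈ Λ₀(f)`), a rational series `g_F ∈ ℚ⟦X⟧` and a family of series `𝒮 : ℂ → ℂ⟦X⟧` such that for all `w, w' ∈ Λ₀(f)`: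
`F_w` is holomorphic; `F_w ∣_K g` is bounded at `i∞` for every `g ∈ SL₂(ℤ)`; `F_w ∣_K γ = F_{w + {∞,γ∞}_f}` for `γ ∈ Γ₀(N)`; `F_w = F_{w'}` if
`w − w' ∈ Λ_W`; `F_w τ = 12℘_{Λ_W}(ℰ_f τ + w)·G τ·Δ τ^a` whenever `ℰ_f τ + w ∉ Λ_W`; high in the cusp `ℰ_f τ ∉ Λ_W`, `Σ (g_F)ₙ 𝕢τⁿ = F_w τ` for
`w ∈ Λ_W`, and `ℰ_f τ + w ∉ Λ_W`, `Σ (𝒮 e_w)ₙ 𝕢τⁿ = F_w τ` (`e_w = ℘_{Λ_W} w`) for `w ∉ Λ_W` with `2w ∈ Λ_W`; finally `(𝒮 e).map σ = 𝒮 (σ e)` for every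
ring endomorphism `σ` of `ℂ`.  (`F_w = F ∣ γ_w` for the `c`-division witness `F` and any `γ_w ∈ Γ₀(N)` of period `w`.)
[cite: ShimuraIATAF1971, §2.4, Thm. 7.14] [cite: Manin1972, Prop. 1.4] [cite: Honda1970, Thm. 9] [cite: Lawden1989, §6.8 eq. (6.8.11)] -/
theorem exists_translateFamily (W : WeierstrassCurve ℚ) [W.IsElliptic] [W.IsGloballyMinimal]
    (D : ModularParametrizationData W N) :
    ∃ (K : ℤ) (a : ℕ) (k : ℤ) (G : CuspForm (Gamma0 N) k) (Fw : ℂ → ℍ → ℂ) (gF : ℚ⟦X⟧) (𝒮 : ℂ → ℂ⟦X⟧),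
      K = k + 12 * (a : ℤ) ∧ 2 ≤ a ∧ G ≠ 0 ∧ (∀ m, ∃ z : ℤ, cuspCoeff G m = z) ∧
      (∀ w ∈ periodLattice D.f, MDifferentiable 𝓘(ℂ) 𝓘(ℂ) (Fw w)) ∧
      (∀ w ∈ periodLattice D.f, ∀ g : SL(2, ℤ), IsBoundedAtImInfty (Fw w ∣[K] g)) ∧
      (∀ w ∈ periodLattice D.f, ∀ γ : Gamma0 N, Fw w ∣[K] (γ : SL(2, ℤ)) = Fw (w + cuspSymbol D.f γ)) ∧
      (∀ w ∈ periodLattice D.f, ∀ w' ∈ periodLattice D.f, w - w' ∈ D.L.lattice → Fw w = Fw w') ∧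
      (∀ w ∈ periodLattice D.f, ∀ τ : ℍ, eichlerIntegral D.f τ + w ∉ D.L.lattice →
        Fw w τ = 12 * ℘[D.L] (eichlerIntegral D.f τ + w) * G τ * ModularForm.discriminant τ ^ a) ∧
      (∃ B : ℝ, ∀ τ : ℍ, B < τ.im → eichlerIntegral D.f τ ∉ D.L.lattice ∧ ∀ w ∈ periodLattice D.f, w ∈ D.L.lattice →
        HasSum (fun n : ℕ ↦ ((coeff n gF : ℚ) : ℂ) * Function.Periodic.qParam 1 (τ : ℂ) ^ n) (Fw w τ)) ∧
      (∀ w ∈ periodLattice D.f, w ∉ D.L.lattice → 2 * w ∈ D.L.lattice → ∃ B : ℝ, ∀ τ : ℍ, B < τ.im →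
        eichlerIntegral D.f τ + w ∉ D.L.lattice ∧
        HasSum (fun n : ℕ ↦ coeff n (𝒮 (℘[D.L] w)) * Function.Periodic.qParam 1 (τ : ℂ) ^ n) (Fw w τ)) ∧
      (∀ (σ : ℂ →+* ℂ) (e : ℂ), (𝒮 e).map σ = 𝒮 (σ e)) := by
  classical
  have hf : D.f ≠ 0 := D.isNewformOf.1.ne_zero
  have hc : (D.c : ℂ) ≠ 0 := D.cast_c_ne_zero
  have hmul := cuspSymbol_mul_holds D.f
  have hinv : ∀ δ : Gamma0 N, cuspSymbol D.f δ⁻¹ = -cuspSymbol D.f δ := fun δ ↦ by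
    have h := hmul δ δ⁻¹
    rw [mul_inv_cancel, cuspSymbol_one] at h
    linear_combination -h
  -- every period is a cusp symbol
  have hsurj : ∀ w ∈ periodLattice D.f, ∃ γ : Gamma0 N, cuspSymbol D.f γ = w := by
    intro w hw
    induction hw using AddSubgroup.closure_induction with
    | mem x hx =>
      obtain ⟨γ, rfl⟩ := hx
      exact ⟨γ, rfl⟩
    | zero => exact ⟨1, cuspSymbol_one D.f⟩
    | add x y _ _ hx hy =>
      obtain ⟨γ, rfl⟩ := hx
      obtain ⟨δ, rfl⟩ := hy
      exact ⟨γ * δ, hmul γ δ⟩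
    | neg x _ hx =>
      obtain ⟨γ, rfl⟩ := hx
      exact ⟨γ⁻¹, hinv γ⟩
  -- the cover group, the exponent, the core
  obtain ⟨Γ, hmem, hle, hfi, -, -⟩ := CDivision.exists_cDivisionCoverSubgroup D
  obtain ⟨a, ha2, hgr⟩ := cDivGrowth_bounded W D Γ hfi
  obtain ⟨k, G, F, _hk, hG0, hGint, hFhol, hFeq, hstab⟩ := CDivision.exists_cDivisionWitnessCore D hc a
  set K : ℤ := k + 12 * (a : ℤ) with hK
  -- `F ∣ γ` only depends on the class of `{∞, γ∞}_f` modulo `Λ_W`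
  have hclass : ∀ γ δ : Gamma0 N, cuspSymbol D.f γ - cuspSymbol D.f δ ∈ D.L.lattice →
      F ∣[K] (γ : SL(2, ℤ)) = F ∣[K] (δ : SL(2, ℤ)) := by
    intro γ δ h
    have hprod : cuspSymbol D.f (γ * δ⁻¹) ∈ D.L.lattice := by
      rw [hmul, hinv, ← sub_eq_add_neg]; exact h
    have h1 : F ∣[K] ((γ * δ⁻¹ : Gamma0 N) : SL(2, ℤ)) = F := (hstab (γ * δ⁻¹)).mp hprod
    have h2 : ((γ : Gamma0 N) : SL(2, ℤ)) = ((γ * δ⁻¹ : Gamma0 N) : SL(2, ℤ)) * (δ : SL(2, ℤ)) := by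
      push_cast; group
    rw [h2, SlashAction.slash_mul, h1]
  -- the family
  set Fw : ℂ → ℍ → ℂ := fun w ↦ if h : w ∈ periodLattice D.f then F ∣[K] ((hsurj w h).choose : SL(2, ℤ)) else 0 with hFw
  have hFw_eq : ∀ w (hw : w ∈ periodLattice D.f) (γ : Gamma0 N), cuspSymbol D.f γ = w → Fw w = F ∣[K] (γ : SL(2, ℤ)) := by
    intro w hw γ hγ
    rw [hFw]
    simp only [dif_pos hw]
    exact hclass _ _ (by rw [(hsurj w hw).choose_spec, hγ, sub_self]; exact zero_mem _)
  -- the series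
  obtain ⟨g, B₁, _hgden, hg⟩ := CDivCuspGerm.cDivCuspSeries W D a ha2
  choose bd hbd using hGint
  have hGsum : ∀ τ : ℍ, HasSum (fun n : ℕ ↦ (bd n : ℂ) * Complex.exp (2 * Real.pi * Complex.I * (τ : ℂ) * n)) (G τ) :=
    CDivAssembly.hasSum_int_of_cuspCoeff G bd hbd
  have hGsum' : ∀ τ : ℍ, HasSum (fun n : ℕ ↦ coeff n ((PowerSeries.mk bd).map (Int.castRingHom ℂ)) *
      Function.Periodic.qParam 1 (τ : ℂ) ^ n) (G τ) := by
    intro τ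
    convert hGsum τ using 1
    funext n
    rw [coeff_map, coeff_mk, eq_intCast, Function.Periodic.qParam]
    congr 1
    rw [← Complex.exp_nat_mul]
    congr 1
    push_cast
    ring
  obtain ⟨T₀, hT₀⟩ := exists_forall_eichlerIntegral_smul_notMem D.f hf D.L 1
  obtain ⟨S, hSσ, _hS0, hS⟩ := exists_halfPeriodSeries W D
  -- Δ^a as an integer series
  have hΔa : ∀ τ : ℍ, HasSum (fun n : ℕ ↦ coeff n (((X * formalDeltaUnit) ^ a : ℤ⟦X⟧).map (Int.castRingHom ℂ)) *
      Function.Periodic.qParam 1 (τ : ℂ) ^ n) (ModularForm.discriminant τ ^ a) := by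
    intro τ
    have h := CDivCuspGerm.hasSum_intCoeff_pow (Literature.NumberTheory.EllipticCurves.hasSum_X_mul_formalDeltaUnit τ) a
    convert h using 2 with n
    rw [coeff_map, eq_intCast]
  set Gser : ℂ⟦X⟧ := (PowerSeries.mk bd).map (Int.castRingHom ℂ) with hGser
  set Δser : ℂ⟦X⟧ := (((X * formalDeltaUnit) ^ a : ℤ⟦X⟧)).map (Int.castRingHom ℂ) with hΔser
  refine ⟨K, a, k, G, Fw, g * (PowerSeries.mk bd).map (Int.castRingHom ℚ), fun e ↦ S e * Gser * Δser,
    rfl, ha2, hG0, fun m ↦ ⟨bd m, hbd m⟩, ?_, ?_, ?_, ?_, ?_, ?_, ?_, ?_⟩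
  · -- holomorphy
    intro w hw
    obtain ⟨γ, hγ⟩ := hsurj w hw
    rw [hFw_eq w hw γ hγ, ModularForm.SL_slash]
    exact hFhol.slash K _
  · -- boundedness at every cusp
    intro w hw g
    obtain ⟨γ, hγ⟩ := hsurj w hw
    rw [hFw_eq w hw γ hγ, ← SlashAction.slash_mul]
    refine hgr k (G : ModularForm (Gamma0 N) k) F (fun δ hδ ↦ (hstab ⟨δ, hle hδ⟩).mp ((hmem ⟨δ, hle hδ⟩).mp hδ)) (fun τ hτ ↦ ?_) _
    rw [← hFeq τ hτ]
    change _ = ℘[D.L] (eichlerIntegral D.f τ) * ((12 : ℂ) * G τ * ModularForm.discriminant τ ^ a)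
    ring
  · -- translation law
    intro w hw γ
    obtain ⟨γw, hγw⟩ := hsurj w hw
    have hw' : w + cuspSymbol D.f γ ∈ periodLattice D.f := add_mem hw (AddSubgroup.subset_closure ⟨γ, rfl⟩)
    rw [hFw_eq w hw γw hγw, hFw_eq _ hw' (γw * γ) (by rw [hmul, hγw]), ← SlashAction.slash_mul]
    rfl
  · -- class dependence
    intro w hw w' hw' hww'
    obtain ⟨γ, hγ⟩ := hsurj w hw
    obtain ⟨γ', hγ'⟩ := hsurj w' hw'
    rw [hFw_eq w hw γ hγ, hFw_eq w' hw' γ' hγ']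
    exact hclass γ γ' (by rw [hγ, hγ']; exact hww')
  · -- the presentation of `F_w` off the poles
    intro w hw τ hτ
    obtain ⟨γ, hγ⟩ := hsurj w hw
    have hE : eichlerIntegral D.f ((γ : SL(2, ℤ)) • τ) = eichlerIntegral D.f τ + w := by
      rw [← hγ]; linear_combination eichlerIntegral_smul_sub_holds D.f γ τ
    have hKnat : ((k.toNat + 12 * a : ℕ) : ℤ) = k + 12 * a := by
      push_cast; rw [Int.toNat_of_nonneg (by omega)]
    have hd : denom ((γ : SL(2, ℤ)) : GL (Fin 2) ℝ) τ ≠ 0 := denom_ne_zero _ τ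
    rw [hFw_eq w hw γ hγ, ModularForm.SL_slash_apply, ← hFeq _ (by rw [hE]; exact hτ), hE]
    have hGΔ := CDivision.twelve_mul_mul_discriminant_pow_apply_smul G a (k.toNat + 12 * a) hKnat (γ : SL(2, ℤ)) γ.2 τ
    have e1 : 12 * ℘[D.L] (eichlerIntegral D.f τ + w) * G ((γ : SL(2, ℤ)) • τ) * ModularForm.discriminant ((γ : SL(2, ℤ)) • τ) ^ a =
        ℘[D.L] (eichlerIntegral D.f τ + w) * (12 * G ((γ : SL(2, ℤ)) • τ) * ModularForm.discriminant ((γ : SL(2, ℤ)) • τ) ^ a) := by ring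
    rw [e1, hGΔ, hK, ← hKnat, zpow_neg, zpow_natCast]
    have : denom ((γ : SL(2, ℤ)) : GL (Fin 2) ℝ) τ = denom (γ : SL(2, ℤ)) τ := rfl
    field_simp
  · -- the series of `F` itself
    refine ⟨max B₁ T₀, fun τ hτ ↦ ?_⟩
    have hB₁ : B₁ < τ.im := (le_max_left _ _).trans_lt hτ
    have hT : eichlerIntegral D.f τ ∉ D.L.lattice := by simpa using hT₀ τ ((le_max_right _ _).trans hτ.le)
    refine ⟨hT, fun w hw hwΛ ↦ ?_⟩
    obtain ⟨γ, hγ⟩ := hsurj w hw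
    have hF1 : Fw w = F := by
      rw [hFw_eq w hw γ hγ]; exact (hstab γ).mp (by rw [hγ]; exact hwΛ)
    rw [hF1, ← hFeq τ hT]
    have hg' : HasSum (fun n : ℕ ↦ coeff n (g.map (algebraMap ℚ ℂ)) * Function.Periodic.qParam 1 (τ : ℂ) ^ n)
        ((12 : ℂ) * ℘[D.L] (eichlerIntegral D.f τ) * ModularForm.discriminant τ ^ a) := by
      convert hg τ hB₁ using 2 with n
      rw [coeff_map]; rfl
    have hprod := Summit.BirchSwinnertonDyer.BirchSwinnertonDyer.Theorems.ManinLocalTwoThree.KummerCubeSigmaLeaves.hasSum_coeff_mul_pow_mul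
      hg' (hGsum' τ)
    have hval : (12 : ℂ) * ℘[D.L] (eichlerIntegral D.f τ) * ModularForm.discriminant τ ^ a * G τ =
        12 * ℘[D.L] (eichlerIntegral D.f τ) * G τ * ModularForm.discriminant τ ^ a := by ring
    rw [hval] at hprod
    have hGserQ : Gser = ((PowerSeries.mk bd).map (Int.castRingHom ℚ)).map (algebraMap ℚ ℂ) := by
      ext n; simp [hGser, coeff_map]
    convert hprod using 2 with n
    rw [hGserQ, ← (PowerSeries.map (algebraMap ℚ ℂ)).map_mul, coeff_map]
    rfl
  · -- the series of a half-period translate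
    intro w hw hwΛ h2w
    obtain ⟨B₂, hB₂⟩ := hS w hwΛ h2w
    refine ⟨B₂, fun τ hτ ↦ ?_⟩
    obtain ⟨hΛ, hsum⟩ := hB₂ τ hτ
    refine ⟨hΛ, ?_⟩
    obtain ⟨γ, hγ⟩ := hsurj w hw
    have hval : Fw w τ = 12 * ℘[D.L] (eichlerIntegral D.f τ + w) * G τ * ModularForm.discriminant τ ^ a := by
      -- re-use the presentation clause (proved above as the 5th conjunct); re-derive locally
      have hE : eichlerIntegral D.f ((γ : SL(2, ℤ)) • τ) = eichlerIntegral D.f τ + w := by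
        rw [← hγ]; linear_combination eichlerIntegral_smul_sub_holds D.f γ τ
      have hKnat : ((k.toNat + 12 * a : ℕ) : ℤ) = k + 12 * a := by
        push_cast; rw [Int.toNat_of_nonneg (by omega)]
      have hd : denom ((γ : SL(2, ℤ)) : GL (Fin 2) ℝ) τ ≠ 0 := denom_ne_zero _ τ
      rw [hFw_eq w hw γ hγ, ModularForm.SL_slash_apply, ← hFeq _ (by rw [hE]; exact hΛ), hE]
      have hGΔ := CDivision.twelve_mul_mul_discriminant_pow_apply_smul G a (k.toNat + 12 * a) hKnat (γ : SL(2, ℤ)) γ.2 τ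
      have e1 : 12 * ℘[D.L] (eichlerIntegral D.f τ + w) * G ((γ : SL(2, ℤ)) • τ) * ModularForm.discriminant ((γ : SL(2, ℤ)) • τ) ^ a =
          ℘[D.L] (eichlerIntegral D.f τ + w) * (12 * G ((γ : SL(2, ℤ)) • τ) * ModularForm.discriminant ((γ : SL(2, ℤ)) • τ) ^ a) := by ring
      rw [e1, hGΔ, hK, ← hKnat, zpow_neg, zpow_natCast]
      have : denom ((γ : SL(2, ℤ)) : GL (Fin 2) ℝ) τ = denom (γ : SL(2, ℤ)) τ := rfl
      field_simp
    rw [hval]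
    have h1 := Summit.BirchSwinnertonDyer.BirchSwinnertonDyer.Theorems.ManinLocalTwoThree.KummerCubeSigmaLeaves.hasSum_coeff_mul_pow_mul
      hsum (hGsum' τ)
    have h2 := Summit.BirchSwinnertonDyer.BirchSwinnertonDyer.Theorems.ManinLocalTwoThree.KummerCubeSigmaLeaves.hasSum_coeff_mul_pow_mul
      h1 (hΔa τ)
    convert h2 using 1
  · -- `Aut ℂ`-equivariance of the series
    intro σ e
    have hG : Gser.map σ = Gser := by ext n; simp only [hGser, coeff_map, coeff_mk, eq_intCast, map_intCast]
    have hΔ : Δser.map σ = Δser := by ext n; simp only [hΔser, coeff_map, eq_intCast, map_intCast]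
    show (S e * Gser * Δser).map σ = S (σ e) * Gser * Δser
    rw [(PowerSeries.map σ).map_mul, (PowerSeries.map σ).map_mul, hSσ, hG, hΔ]

end Summit.BirchSwinnertonDyer.BirchSwinnertonDyer.Theorems.ManinLocalTwoThree.CDivTranslate

end
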